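import Summits.BirchSwinnertonDyer.BirchSwinnertonDyer.Theorems.CountingDoorF2AtThreeSelmerAverageInterface
import HarnessLib

/-!
# BirchSwinnertonDyer / CountingDoorF2AtThree — support for crux I1 `SelmerThreeAverageLargeF2`
# (stmt-BirchSwinnertonDyer-19440): the ONE-GENERATOR split `36 = 3 + 33` (receptacle HE(33) of
# the orbit-counting line `shared-face-rubik-pairs`)

Route `route-BirchSwinnertonDyer-CountingDoorF2AtThree` (cell bsd-rank2; seat `bsd-rank2-sel3-p2`,
the ORBIT-COUNTING lane on I1). The interface file
`CountingDoorF2AtThreeSelmerAverageInterface` (eng-2) reduces I1 on a large `Φ ⊆ F₂` to a count,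
with average `≤ 27 = 36 − 9`, of the `3`-Selmer classes outside the TWO-generator marked subgroup
`S'(E_a) = ⟨κ P₁, κ P₂⟩`. The fibred form of the crux card `shared-face-rubik-pairs` (L0 of its
`Sketch.lean`; "Why it bites (3)") counts differently: after the fibred embedding
`(E_a; P₁, P₂) ≅ (y² + A₃y = x³ + A₂x² + A₄x; (0,0), (r, rt))` (file
`CountingDoorF2AtThreeFibredEmbedding`) the Rubik-cube parametrisation of BH22 Thm. 3.1 line 4
sees EVERY `3`-Selmer class outside the ONE-generator subgroup `⟨κ P₁⟩` of the `F₁`-marked point as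
an irreducible orbit — including the six classes of `⟨κ P₁, κ P₂⟩ ∖ ⟨κ P₁⟩` — so the count it must
deliver has constant `33 = 27 + 6 = 36 − 3`. This file is that receptacle, parametrisation-agnostic
and with no hypothesis beyond the count:

* §1 one element killed by `n` generates `≤ n` elements (`natCard_closure_singleton_le`, via
  `ℤ/n → B`); for every curve over a number field and the tree's Kummer map,
  `#⟨κ P⟩ ≤ n` (`natCard_closure_kummer_singleton_le`) and
  `#Sel_n ≤ n + #(Sel_n ∖ ⟨κ P⟩)` (`natCard_selmerGroup_le_add_ncard_diff_singleton`);
* §2 on `F₂` at `n = 3`: `#Sel₃(E_a) ≤ 3 + #(Sel₃(E_a) ∖ ⟨κ P₁⟩)` and the same with `P₂`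
  (`natCard_selmerGroup_three_le_three_add_nonP₁/₂`);
* §3 **I1 on `Φ` from an average `≤ 33` of the classes outside `⟨κ P₁⟩`**
  (`selmerThreeAverageLE_of_nonP₁`), its injection/count form with finite types of size
  `≤ (33 + ε)·#Φ(<X)` (`selmerThreeAverageLE_of_injective_nonP₁` — the exact shape HE(33) must
  deliver), and the route decl BY NAME on every large `Φ` (`selmerThreeAverageLargeF2_of_nonP₁`,
  `selmerThreeAverageLargeF2_of_injective_nonP₁`); the `P₂`-versions by symmetry.

PARTITION: none — r_an ≥ 2, summit axis S0; TWIN (D-0056): n/a. B1 honesty: bookkeeping toward an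
OPEN crux (the count HE(33) is not in print); no analytic rank, no `L`-function; no S0 motion.

References: M. Bhargava, W. Ho, arXiv:2207.03309 (2022), §2 items (5)–(7), Thm. 3.1 (line 4 and
(c)) [BhargavaHo2022]; B. Poonen, E. Rains, J. AMS 25 (2012) [PoonenRains2012]; J. H. Silverman,
*AEC* VIII.§2, X.4.2 [SilvermanAEC2009].
-/

set_option linter.dupNamespace false

noncomputable section

open scoped Classical
open Filter Topology Finset
open WeierstrassCurve Literature.NumberTheory.EllipticCurves
  Literature.NumberTheory.EllipticCurves.BhargavaHo2022
  Summit.BirchSwinnertonDyer.Rank2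
  Summit.BirchSwinnertonDyer.BirchSwinnertonDyer.Theses.CountingDoorF2AtThree

namespace Summit.BirchSwinnertonDyer.BirchSwinnertonDyer.Theorems

universe w

variable (Φ : CongruenceFamily₂)

/-! ### §1 One element killed by `n` generates at most `n` elements -/

/-- **One element killed by `n` generates a finite subgroup with at most `n` elements** (`n = m`,
`m ≥ 1` a natural number): `⟨x⟩` is the image of `ℤ/m → B`, `i ↦ i•x`. [folklore] -/
theorem natCard_closure_singleton_le {B : Type w} [AddCommGroup B] {n : ℤ} {m : ℕ} (hm : m ≠ 0)
    (hmn : (m : ℤ) = n) {x : B} (hx : n • x = 0) :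
    Finite (AddSubgroup.closure ({x} : Set B)) ∧
      Nat.card (AddSubgroup.closure ({x} : Set B)) ≤ m := by
  haveI : NeZero m := ⟨hm⟩
  subst hmn
  let φ : ZMod m →+ B := ZMod.lift m ⟨zmultiplesHom B x, by simpa using hx⟩
  have key : ∀ i : ℤ, φ (i : ZMod m) = i • x := fun i ↦ by
    simp [φ, ZMod.lift_coe]
  have hle : AddSubgroup.closure ({x} : Set B) ≤ φ.range := by
    rw [AddSubgroup.closure_le]
    rintro z rfl
    exact ⟨((1 : ℤ) : ZMod m), by rw [key]; simp⟩
  haveI hfin : Finite φ.range := Finite.of_surjective _ φ.rangeRestrict_surjective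
  refine ⟨Finite.of_injective _ (AddSubgroup.inclusion_injective hle), ?_⟩
  calc Nat.card (AddSubgroup.closure ({x} : Set B))
      ≤ Nat.card φ.range := Nat.card_le_card_of_injective _ (AddSubgroup.inclusion_injective hle)
    _ ≤ Nat.card (ZMod m) := Nat.card_le_card_of_surjective _ φ.rangeRestrict_surjective
    _ = m := Nat.card_zmod m

section AnyCurve

variable {K : Type} [Field K] (W : WeierstrassCurve K) [PerfectField K]

/-- **The Kummer image of one point has at most `n` elements.** For the tree's Kummer map
`κ : E(K) → H¹(K, E[n])` (`n = m ≥ 1`) and `P ∈ E(K)`, the subgroup `⟨κ P⟩` is finite with at most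
`m` elements, for EVERY curve (`κ(nP) = 0`, `kummerMapTorsion_apply_zsmul`).
[cite: SilvermanAEC2009, §VIII.2 (Kummer sequence)] -/
theorem natCard_closure_kummer_singleton_le {n : ℤ} {m : ℕ} (hm : m ≠ 0) (hmn : (m : ℤ) = n)
    (hdiv : ∀ P : W.geomPoints, ∃ Q : W.geomPoints, n • Q = P) (P : W.toAffine.Point) :
    Finite (AddSubgroup.closure ({W.kummerMapTorsion n hdiv P} : Set (W.galH1Torsion n))) ∧
      Nat.card (AddSubgroup.closure ({W.kummerMapTorsion n hdiv P} : Set (W.galH1Torsion n))) ≤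
        m :=
  natCard_closure_singleton_le hm hmn
    (by rw [← map_zsmul, kummerMapTorsion_apply_zsmul W hdiv])

variable [NumberField K]

/-- **`#Sel_n(E) ≤ n + #(Sel_n(E) ∖ ⟨κ P⟩)`**: the `n`-Selmer group splits into the Kummer image of
`⟨P⟩` (at most `n` classes) and the rest. [cite: BhargavaHo2022, §2 item (7) (shape: add back the marked classes)] -/
theorem natCard_selmerGroup_le_add_ncard_diff_singleton {n : ℤ} {m : ℕ} (hm : m ≠ 0)
    (hmn : (m : ℤ) = n) (hdiv : ∀ P : W.geomPoints, ∃ Q : W.geomPoints, n • Q = P)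
    (P : W.toAffine.Point) :
    (Nat.card (W.selmerGroup n) : ℝ) ≤ (m : ℝ) +
      ((W.selmerGroup n : Set (W.galH1Torsion n)) \
        (AddSubgroup.closure ({W.kummerMapTorsion n hdiv P} : Set (W.galH1Torsion n)) :
          Set (W.galH1Torsion n))).ncard := by
  set S' : AddSubgroup (W.galH1Torsion n) :=
    AddSubgroup.closure ({W.kummerMapTorsion n hdiv P} : Set (W.galH1Torsion n)) with hS'
  obtain ⟨hfin, hle⟩ := natCard_closure_kummer_singleton_le W hm hmn hdiv P
  have hsplit := Set.ncard_le_ncard_sdiff_add_ncard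
    (W.selmerGroup n : Set (W.galH1Torsion n)) (S' : Set (W.galH1Torsion n)) (Set.toFinite _)
  have hS'card : (S' : Set (W.galH1Torsion n)).ncard ≤ m := by
    rw [← Nat.card_coe_set_eq]; exact hle
  have h1 : Nat.card (W.selmerGroup n) = (W.selmerGroup n : Set (W.galH1Torsion n)).ncard := by
    rw [← Nat.card_coe_set_eq]; rfl
  have h2 : ((W.selmerGroup n : Set (W.galH1Torsion n)).ncard : ℝ) ≤
      ((W.selmerGroup n : Set (W.galH1Torsion n)) \ (S' : Set (W.galH1Torsion n))).ncard +
        (S' : Set (W.galH1Torsion n)).ncard := by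
    exact_mod_cast hsplit
  have h3 : ((S' : Set (W.galH1Torsion n)).ncard : ℝ) ≤ (m : ℝ) := by exact_mod_cast hS'card
  rw [h1]; linarith

end AnyCurve

/-! ### §2 On `F₂` at `n = 3`: `#Sel₃(E_a) ≤ 3 + #(Sel₃(E_a) ∖ ⟨κ P₁⟩)` (and with `P₂`) -/

/-- **`#Sel₃(E_a) ≤ 3 + #(Sel₃(E_a) ∖ ⟨κ P₁⟩)`** for every member `a` of `F₂`: the ONE-generator
split at the first marked point `P₁ = (a₂, 0)` — the marked point `(0, 0)` of the fibred
`F₁`-model. [cite: BhargavaHo2022, Thm. 3.1(c) (S'(E) for F₁ = ⟨κ(marked point)⟩) and §2 item (7)] -/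
theorem natCard_selmerGroup_three_le_three_add_nonP₁ {a : Params} (h : a.IsMember)
    (hdiv : ∀ P : a.curve.geomPoints, ∃ Q : a.curve.geomPoints, (3 : ℤ) • Q = P) :
    (Nat.card (a.curve.selmerGroup 3) : ℝ) ≤ 3 +
      ((a.curve.selmerGroup 3 : Set (a.curve.galH1Torsion 3)) \
        (AddSubgroup.closure ({a.curve.kummerMapTorsion 3 hdiv (Params.markedPoint₁ h)} :
          Set (a.curve.galH1Torsion 3)) : Set (a.curve.galH1Torsion 3))).ncard := by
  have h3 := natCard_selmerGroup_le_add_ncard_diff_singleton a.curve (n := 3) (m := 3)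
    (by norm_num) (by norm_num) hdiv (Params.markedPoint₁ h)
  norm_num at h3; exact h3

/-- **`#Sel₃(E_a) ≤ 3 + #(Sel₃(E_a) ∖ ⟨κ P₂⟩)`**, the same split at the second marked point
`P₂ = (a₂', 0)` (the family `F₂` is symmetric under `a₂ ↔ a₂'`). [cite: BhargavaHo2022, Thm. 3.1(c) and §2 item (7)] -/
theorem natCard_selmerGroup_three_le_three_add_nonP₂ {a : Params} (h : a.IsMember)
    (hdiv : ∀ P : a.curve.geomPoints, ∃ Q : a.curve.geomPoints, (3 : ℤ) • Q = P) :
    (Nat.card (a.curve.selmerGroup 3) : ℝ) ≤ 3 +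
      ((a.curve.selmerGroup 3 : Set (a.curve.galH1Torsion 3)) \
        (AddSubgroup.closure ({a.curve.kummerMapTorsion 3 hdiv (Params.markedPoint₂ h)} :
          Set (a.curve.galH1Torsion 3)) : Set (a.curve.galH1Torsion 3))).ncard := by
  have h3 := natCard_selmerGroup_le_add_ncard_diff_singleton a.curve (n := 3) (m := 3)
    (by norm_num) (by norm_num) hdiv (Params.markedPoint₂ h)
  norm_num at h3; exact h3

/-! ### §3 I1 from a count with constant `33` of the classes outside `⟨κ P₁⟩` (receptacle HE(33)) -/

/-- **I1 on `Φ` from a count of the `3`-Selmer classes outside `⟨κ P₁⟩`** (the split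
`36 = 3 + 33`). If `g` dominates, on every member `a` of `Φ`, the number of `3`-Selmer classes of
`E_a` outside the one-generator subgroup `⟨κ P₁⟩`, and `Φ.AverageOnLE g 33`, then
`Φ.AverageOnLE (fun a ↦ #Sel₃(E_a)) 36`. This is the lever L0 of the crux card
`shared-face-rubik-pairs` (fibred form: the Rubik-cube count over the `F₁`-models sees every class
outside `⟨κ(0,0)⟩` as an irreducible orbit, `33 = 27 + 6`). [cite: BhargavaHo2022, §2 item (7) and Thm. 3.1 (line 4, (c))] -/
theorem selmerThreeAverageLE_of_nonP₁ {g : Params → ℝ} (hg : Φ.AverageOnLE g 33)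
    (hle : ∀ a, Φ.Mem a → ∀ (h : a.IsMember)
      (hdiv : ∀ P : a.curve.geomPoints, ∃ Q : a.curve.geomPoints, (3 : ℤ) • Q = P),
      (((a.curve.selmerGroup 3 : Set (a.curve.galH1Torsion 3)) \
        (AddSubgroup.closure ({a.curve.kummerMapTorsion 3 hdiv (Params.markedPoint₁ h)} :
          Set (a.curve.galH1Torsion 3)) : Set (a.curve.galH1Torsion 3))).ncard : ℝ) ≤ g a) :
    Φ.AverageOnLE (fun a ↦ (Nat.card (a.curve.selmerGroup 3) : ℝ)) 36 := by
  have h36 : (36 : ℝ) = 3 + 33 := by norm_num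
  rw [h36]
  have hsum : Φ.AverageOnLE (fun a ↦ (3 : ℝ) + g a) (3 + 33) :=
    averageOnLE_add Φ (averageOnLE_of_forall_le Φ (by norm_num) fun _ _ ↦ le_rfl) hg
  refine averageOnLE_mono Φ hsum fun a ha ↦ ?_
  have h : a.IsMember := ha.1
  have hdiv := three_zsmul_geomPoints_surjective h
  have h3 := natCard_selmerGroup_three_le_three_add_nonP₁ h hdiv
  linarith [hle a ha h hdiv]

/-- The same lever at the second marked point: an average `≤ 33` of the classes outside `⟨κ P₂⟩`
gives `Φ.AverageOnLE (fun a ↦ #Sel₃(E_a)) 36`. [cite: BhargavaHo2022, §2 item (7) and Thm. 3.1(c)] -/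
theorem selmerThreeAverageLE_of_nonP₂ {g : Params → ℝ} (hg : Φ.AverageOnLE g 33)
    (hle : ∀ a, Φ.Mem a → ∀ (h : a.IsMember)
      (hdiv : ∀ P : a.curve.geomPoints, ∃ Q : a.curve.geomPoints, (3 : ℤ) • Q = P),
      (((a.curve.selmerGroup 3 : Set (a.curve.galH1Torsion 3)) \
        (AddSubgroup.closure ({a.curve.kummerMapTorsion 3 hdiv (Params.markedPoint₂ h)} :
          Set (a.curve.galH1Torsion 3)) : Set (a.curve.galH1Torsion 3))).ncard : ℝ) ≤ g a) :
    Φ.AverageOnLE (fun a ↦ (Nat.card (a.curve.selmerGroup 3) : ℝ)) 36 := by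
  have h36 : (36 : ℝ) = 3 + 33 := by norm_num
  rw [h36]
  have hsum : Φ.AverageOnLE (fun a ↦ (3 : ℝ) + g a) (3 + 33) :=
    averageOnLE_add Φ (averageOnLE_of_forall_le Φ (by norm_num) fun _ _ ↦ le_rfl) hg
  refine averageOnLE_mono Φ hsum fun a ha ↦ ?_
  have h : a.IsMember := ha.1
  have hdiv := three_zsmul_geomPoints_surjective h
  have h3 := natCard_selmerGroup_three_le_three_add_nonP₂ h hdiv
  linarith [hle a ha h hdiv]

/-- **The route decl I1 from the one-generator count on every large `Φ`** (BY NAME): if for every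
large subfamily `Φ` of `F₂` some `g` with `Φ.AverageOnLE g 33` dominates member-wise the number of
`3`-Selmer classes outside `⟨κ P₁⟩`, then `SelmerThreeAverageLargeF2`. The hypothesis is the count
HE(33) of the orbit-counting line (open). [cite: BhargavaHo2022, Thm. 1.1 (the F₁ 3-Selmer average 12 = 3 + 9, shape) and §2 item (7)] -/
theorem selmerThreeAverageLargeF2_of_nonP₁
    (H : ∀ Φ : CongruenceFamily₂, Φ.IsLarge → ∃ g : Params → ℝ, Φ.AverageOnLE g 33 ∧
      ∀ a, Φ.Mem a → ∀ (h : a.IsMember)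
        (hdiv : ∀ P : a.curve.geomPoints, ∃ Q : a.curve.geomPoints, (3 : ℤ) • Q = P),
        (((a.curve.selmerGroup 3 : Set (a.curve.galH1Torsion 3)) \
          (AddSubgroup.closure ({a.curve.kummerMapTorsion 3 hdiv (Params.markedPoint₁ h)} :
            Set (a.curve.galH1Torsion 3)) : Set (a.curve.galH1Torsion 3))).ncard : ℝ) ≤ g a) :
    SelmerThreeAverageLargeF2 := by
  intro Φ hΦ
  obtain ⟨g, hg, hle⟩ := H Φ hΦ
  exact selmerThreeAverageLE_of_nonP₁ Φ hg hle

/-- The route decl I1 from the one-generator count at the SECOND marked point on every large `Φ`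
(BY NAME; symmetric to `selmerThreeAverageLargeF2_of_nonP₁` under `a₂ ↔ a₂'`).
[cite: BhargavaHo2022, Thm. 1.1 (shape) and §2 item (7)] -/
theorem selmerThreeAverageLargeF2_of_nonP₂
    (H : ∀ Φ : CongruenceFamily₂, Φ.IsLarge → ∃ g : Params → ℝ, Φ.AverageOnLE g 33 ∧
      ∀ a, Φ.Mem a → ∀ (h : a.IsMember)
        (hdiv : ∀ P : a.curve.geomPoints, ∃ Q : a.curve.geomPoints, (3 : ℤ) • Q = P),
        (((a.curve.selmerGroup 3 : Set (a.curve.galH1Torsion 3)) \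
          (AddSubgroup.closure ({a.curve.kummerMapTorsion 3 hdiv (Params.markedPoint₂ h)} :
            Set (a.curve.galH1Torsion 3)) : Set (a.curve.galH1Torsion 3))).ncard : ℝ) ≤ g a) :
    SelmerThreeAverageLargeF2 := by
  intro Φ hΦ
  obtain ⟨g, hg, hle⟩ := H Φ hΦ
  exact selmerThreeAverageLE_of_nonP₂ Φ hg hle

/-! ### §3b The count interface with constant `33`: injecting the pairs `(a, ξ ∉ ⟨κ P₁⟩)` -/

/-- The set of `3`-Selmer classes of `E_a` outside `⟨κ P₁⟩` is finite on members (it lies in the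
finite group `Sel₃(E_a)`, tree theorem `finite_selmerGroup_holds`). [cite: SilvermanAEC2009, Thm X.4.2(b)] -/
theorem finite_nonP₁Selmer {a : Params} (h : a.IsMember) :
    Finite {ξ : a.curve.galH1Torsion 3 | ξ ∈ a.curve.selmerGroup 3 ∧ ∀ h' : a.IsMember,
      ξ ∉ AddSubgroup.closure
        ({a.curve.kummerMapTorsion 3 (three_zsmul_geomPoints_surjective h')
          (Params.markedPoint₁ h')} : Set (a.curve.galH1Torsion 3))} := by
  haveI := Params.isElliptic_curve h
  haveI : Finite (a.curve.selmerGroup 3) := a.curve.finite_selmerGroup_holds (by norm_num)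
  exact Set.Finite.subset (s := (a.curve.selmerGroup 3 : Set (a.curve.galH1Torsion 3)))
    (Set.toFinite _) fun ξ hξ ↦ hξ.1

/-- On a member, the set of classes outside `⟨κ P₁⟩` IS `Sel₃(E_a) ∖ ⟨κ P₁⟩` for any choice of the
(proof-irrelevant) divisibility datum of the Kummer map. [folklore] -/
theorem nonP₁Selmer_eq_diff {a : Params} (h : a.IsMember)
    (hdiv : ∀ P : a.curve.geomPoints, ∃ Q : a.curve.geomPoints, (3 : ℤ) • Q = P) :
    {ξ : a.curve.galH1Torsion 3 | ξ ∈ a.curve.selmerGroup 3 ∧ ∀ h' : a.IsMember,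
      ξ ∉ AddSubgroup.closure
        ({a.curve.kummerMapTorsion 3 (three_zsmul_geomPoints_surjective h')
          (Params.markedPoint₁ h')} : Set (a.curve.galH1Torsion 3))} =
    (a.curve.selmerGroup 3 : Set (a.curve.galH1Torsion 3)) \
      (AddSubgroup.closure ({a.curve.kummerMapTorsion 3 hdiv (Params.markedPoint₁ h)} :
        Set (a.curve.galH1Torsion 3)) : Set (a.curve.galH1Torsion 3)) := by
  ext ξ
  simp only [Set.mem_setOf_eq, Set.mem_sdiff, SetLike.mem_coe]
  exact ⟨fun hξ ↦ ⟨hξ.1, hξ.2 h⟩, fun hξ ↦ ⟨hξ.1, fun _ ↦ hξ.2⟩⟩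

/-- **The count interface HE(33) on one family.** If for every `ε > 0` and all large `X` the pairs
`(a, ξ)` — `a ∈ Φ(<X)`, `ξ` a `3`-Selmer class of `E_a` OUTSIDE `⟨κ P₁⟩` (the classes the fibred
Rubik-cube count sees as irreducible orbits of the `F₁`-model) — inject into a finite type of size
`≤ (33 + ε) · #Φ(<X)`, then `Φ.AverageOnLE (fun a ↦ #Sel₃(E_a)) 36`.
[cite: BhargavaHo2022, Thm. 3.1 (line 4, (c)) and §2 items (5)–(7)] -/
theorem selmerThreeAverageLE_of_injective_nonP₁
    (H : ∀ ε : ℝ, 0 < ε → ∀ᶠ X : ℕ in atTop, ∃ (β : Type) (_ : Finite β)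
      (ι : (Σ a : Φ.below X, {ξ : a.1.curve.galH1Torsion 3 | ξ ∈ a.1.curve.selmerGroup 3 ∧
        ∀ h' : a.1.IsMember, ξ ∉ AddSubgroup.closure
          ({a.1.curve.kummerMapTorsion 3 (three_zsmul_geomPoints_surjective h')
              (Params.markedPoint₁ h')} : Set (a.1.curve.galH1Torsion 3))}) → β),
      Function.Injective ι ∧ (Nat.card β : ℝ) ≤ (33 + ε) * (Φ.below X).card) :
    Φ.AverageOnLE (fun a ↦ (Nat.card (a.curve.selmerGroup 3) : ℝ)) 36 := by
  have hg := averageOnLE_natCard_of_injective Φ (c := 33) (by norm_num)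
    (S := fun a : Params ↦ {ξ : a.curve.galH1Torsion 3 | ξ ∈ a.curve.selmerGroup 3 ∧
        ∀ h' : a.IsMember, ξ ∉ AddSubgroup.closure
          ({a.curve.kummerMapTorsion 3 (three_zsmul_geomPoints_surjective h')
              (Params.markedPoint₁ h')} : Set (a.curve.galH1Torsion 3))})
    (fun a ha ↦ finite_nonP₁Selmer ha.1) H
  refine selmerThreeAverageLE_of_nonP₁ Φ hg fun a _ h hdiv ↦ ?_
  rw [← nonP₁Selmer_eq_diff h hdiv, ← Nat.card_coe_set_eq]

/-- **The count interface HE(33) for the route decl I1** (`SelmerThreeAverageLargeF2`, BY NAME): it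
suffices to inject, for every large `Φ ⊆ F₂`, every `ε > 0` and all large `X`, the pairs
`(a, ξ ∉ ⟨κ P₁⟩)` over `Φ(<X)` into finite types of size `≤ (33 + ε) · #Φ(<X)` — the count the
fibred Rubik-cube line would deliver (its open content: equidistribution of the cube invariants on
the pencil of planes `r A₂ − t A₃ + A₄ = r t² − r²`). [cite: BhargavaHo2022, Thm. 1.1/3.1 (F₁, line 4) and §2 (5)–(7)] -/
theorem selmerThreeAverageLargeF2_of_injective_nonP₁
    (H : ∀ Φ : CongruenceFamily₂, Φ.IsLarge → ∀ ε : ℝ, 0 < ε → ∀ᶠ X : ℕ in atTop,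
      ∃ (β : Type) (_ : Finite β)
      (ι : (Σ a : Φ.below X, {ξ : a.1.curve.galH1Torsion 3 | ξ ∈ a.1.curve.selmerGroup 3 ∧
        ∀ h' : a.1.IsMember, ξ ∉ AddSubgroup.closure
          ({a.1.curve.kummerMapTorsion 3 (three_zsmul_geomPoints_surjective h')
              (Params.markedPoint₁ h')} : Set (a.1.curve.galH1Torsion 3))}) → β),
      Function.Injective ι ∧ (Nat.card β : ℝ) ≤ (33 + ε) * (Φ.below X).card) :
    SelmerThreeAverageLargeF2 := fun Φ hΦ ↦
  selmerThreeAverageLE_of_injective_nonP₁ Φ (H Φ hΦ)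

end Summit.BirchSwinnertonDyer.BirchSwinnertonDyer.Theorems

end
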